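import Summits.RiemannHypothesis.RiemannHypothesis.Theorems.WeilFormatCDataO102BFrontData
import Summits.RiemannHypothesis.RiemannHypothesis.Theorems.WeilFormatCDataO102BTables
import Summits.RiemannHypothesis.RiemannHypothesis.Theorems.WeilFormatCDataA1RungCB
import Summits.RiemannHypothesis.RiemannHypothesis.Theorems.WeilFormatCDataO102BCBOddSchur65
import Summits.RiemannHypothesis.RiemannHypothesis.Theorems.WeilFormatCDataO102BCBOddPsd0
import Summits.RiemannHypothesis.RiemannHypothesis.Theorems.WeilFormatCDataO102BCBOddPsd1
import Summits.RiemannHypothesis.RiemannHypothesis.Theorems.WeilFormatCDataO102BCBOddPsd2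
import Summits.RiemannHypothesis.RiemannHypothesis.Theorems.WeilFormatCDataO102BCBOddPsd3
import Summits.RiemannHypothesis.RiemannHypothesis.Theorems.WeilFormatCDataO102BCBOddPsd4
import Summits.RiemannHypothesis.RiemannHypothesis.Theorems.WeilFormatCDataO102BCBOddPsd5
import Summits.RiemannHypothesis.RiemannHypothesis.Theorems.WeilFormatCDataO102BCBOddPsd6
import Summits.RiemannHypothesis.RiemannHypothesis.Theorems.WeilFormatCDataO102BCBOddPsd7
import Summits.RiemannHypothesis.RiemannHypothesis.Theorems.WeilFormatCDataO102BCBOddPsd8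
import Summits.RiemannHypothesis.RiemannHypothesis.Theorems.WeilFormatCDataO102BCBOddPsd9
import Summits.RiemannHypothesis.RiemannHypothesis.Theorems.WeilFormatCDataO102BCBOddPsd10
import Summits.RiemannHypothesis.RiemannHypothesis.Theorems.WeilFormatCDataO102BCBOddPsdSyS0
import Summits.RiemannHypothesis.RiemannHypothesis.Theorems.WeilFormatCDataO102BCBOddPsdSyS105
import Summits.RiemannHypothesis.RiemannHypothesis.Theorems.WeilFormatCDataO102BCBOddPsdSyS149
import Summits.RiemannHypothesis.RiemannHypothesis.Theorems.WeilFormatCDataO102BCBOddPsdSyS182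
import Summits.RiemannHypothesis.RiemannHypothesis.Theorems.WeilFormatCDataO102BCBOddPsdSyS210
import Summits.RiemannHypothesis.RiemannHypothesis.Theorems.WeilFormatCDataO102BCBOddPsdSyS234
import Summits.RiemannHypothesis.RiemannHypothesis.Theorems.WeilFormatCDataO102BCBOddPsdSyLB
import Summits.RiemannHypothesis.RiemannHypothesis.Theorems.WeilFormatCDataO102BCBOddPsdSyS196
import Summits.RiemannHypothesis.RiemannHypothesis.Theorems.WeilFormatCDataO102BCBOddPsdSyS221
import Summits.RiemannHypothesis.RiemannHypothesis.Theorems.WeilFormatCDataO102BCBOddPsdSyS242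
import Summits.RiemannHypothesis.RiemannHypothesis.Theorems.WeilFormatCDataO102BCBOddPsdSyS250
import Summits.RiemannHypothesis.RiemannHypothesis.Theorems.FormatCPsdSymmBands
import Summits.RiemannHypothesis.RiemannHypothesis.Theorems.S2FormatCE0
import Literature.NumberTheory.LFunctions.YoshidaWindowGramTailMSSines
import Literature.NumberTheory.LFunctions.YoshidaWindowGramMiddleJBox
import Literature.NumberTheory.LFunctions.YoshidaWindowGramTailJFactoredScaled
import Literature.NumberTheory.LFunctions.YoshidaWindowGramTailMSFactored
import Literature.NumberTheory.LFunctions.YoshidaWindowGramTailJDiagTight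
import Summits.RiemannHypothesis.RiemannHypothesis.Theorems.FormatCPsdBands
import Summits.RiemannHypothesis.RiemannHypothesis.Theorems.WeilFormatCDiagShift
import HarnessLib
import Summits.RiemannHypothesis.RiemannHypothesis.Theorems.WeilFormatCDataO102BOddAsmK

/-!
# Format C kernel rung `O102B` (a = 51/50, column-band layout): ASSEMBLY of the flat layout, part L of 12 (ladders of CBOddSchur65, CBOddPsd10; split of the 2697-line assembly at block boundaries by prover B g19 for the 400-line cap; blocks byte-identical): every propositional ladder of the kernel files (table/column validity, front door, sines, middle moments, column data, tail factors, Schur rows, (P) + diagonal shift), byte-identical statements and proofs, original order (A g22 restage_flat.py; weil-2 KERNEL-CHAIN-RULES #1)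

Window `a = 51/50`; prime powers in the window: 2, 3, 2^2, 5, 7; prime constant A = 2148/1000 (`WeilFormatC.primeCoeff_form_ge_cells_v2`); evaluator parameters S = 2^320, Kpi 160, Kser 190, kred 8, Kexp 55, J 150; full table modes < 257; light column table modes < 1027; units 2^-310 (Schur entries), 2^-154 (column digits, width 157), 2^-148 (tail-factor digits, width 151), 2^-64 (reciprocal weights), 2^-40 (tail base); order-J tail J = 4, θ = 1/2048, η = 1/10 | 4/1.
Design row: sr-gb-rung-a A g23 odd λ-run (parity cell 13 L-side): a = 51/50, μ = 2^-93, odd 256/512/1024, HIGHER precision S 2^320 c 310, MS tail, five prime powers; see HOME(A)/LADDER-CELL12-A-g23.md. Generated by sr-gb-rung-a prover A g22 with rh-explicit-weil-2 gen7's generator extended for the odd λ-run (--sector odd --mu-log2; HOME(A)/code-g22/gen7/gramgen7.py sha16 a23c13b0256hp001) from `#eval` of the tree's `Encl` functions; every datum is re-verified by the kernel in the theorem files (`decide +kernel`). Helper data of the rh-explicit Weil-positivity programme (format C, K-CELL-2), RH-free. [cite: Yoshida1992HermitianForms, §5 (5.15)-(5.16) p. 301; §7 pp. 305–312]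
-/

set_option linter.dupNamespace false
set_option exponentiation.threshold 1024
set_option maxRecDepth 200000

-- ===== from WeilFormatCDataO102BCBOddSchur65 =====
namespace Summit.RiemannHypothesis.RiemannHypothesis.Theorems.WeilFormatCData.O102BCBOdd
open Literature.NumberTheory.LFunctions Literature.NumberTheory.LFunctions.Yoshida1992 Encl Literature.Analysis.ValidatedNumerics.NumericsMP
open Summit.RiemannHypothesis.RiemannHypothesis.Theorems.WeilFormatCData.O102B

/-- Schur rows below `256` enclosed (lower triangle). -/
theorem schur256 : SchurNearG (sectorKernel true (gramCoeff O102B.a)) (usubCB (sectorKernel true (gramCoeff O102B.a)) (fun i r ↦ phiJoS O102B.a 256 4 i r) (fun i r ↦ psiMidOS O102B.a (((1 : ℕ) : ℝ) / ((1024 : ℕ) : ℝ)) 256 512 1024 4 (wvF (O102BCBOdd.vw.drop 256) 64 512) i r + psiMSoS O102B.a (((1 : ℕ) : ℝ) / ((2048 : ℕ) : ℝ)) (((4 : ℕ) : ℝ) / ((1 : ℕ) : ℝ)) (((1346682168655 : ℕ) : ℝ) * (1 / 2 ^ 40)) 256 1024 4 (sFun O102B.sd1 O102B.csd) (sFun2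 O102B.sdm O102B.csd) (sFun2 O102B.sdp O102B.csd) i r) (fun i ↦ dMidO O102B.a (((1 : ℕ) : ℝ) / ((1024 : ℕ) : ℝ)) 256 512 1024 4 (wvF (O102BCBOdd.vw.drop 256) 64 512) i + dgJo O102B.a (((1 : ℕ) : ℝ) / ((2048 : ℕ) : ℝ)) (((1346682168655 : ℕ) : ℝ) * (1 / 2 ^ 40)) 256 1024 4 i) 256 256 64 O102BCBOdd.v 8) 256 310 O102BCBOdd.rho O102BCBOdd.DS true 256 := by
  have hT := tab_valid_odd
  have h255 := schur255
  have h256 : SchurNearG (sectorKernel true (gramCoeff a)) (usubCB (sectorKernel true (gramCoeff a)) (fun i r ↦ phiJoS a 256 4 i r) (fun i r ↦ psiMidOS a (((1 : ℕ) : ℝ) / ((1024 : ℕ) : ℝ)) 256 512 1024 4 (wvF (O102BCBOdd.vw.drop 256) 64 512) i r + psiMSoS a (((1 : ℕ) : ℝ) / ((2048 : ℕ) : ℝ)) (((4 : ℕ) : ℝ) / ((1 : ℕ) : ℝ)) (((1346682168655 : ℕ) : ℝ) * (1 / 2 ^ 40)) 256 1024 4 (sFun sd1 csd) (sFun2 sdm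 csd) (sFun2 sdp csd) i r) (fun i ↦ dMidO a (((1 : ℕ) : ℝ) / ((1024 : ℕ) : ℝ)) 256 512 1024 4 (wvF (O102BCBOdd.vw.drop 256) 64 512) i + dgJo a (((1 : ℕ) : ℝ) / ((2048 : ℕ) : ℝ)) (((1346682168655 : ℕ) : ℝ) * (1 / 2 ^ 40)) 256 1024 4 i) 256 256 64 v 8) 256 310 rho DS true (255 + 1) :=
    h255.extend_of_check (S := 2 ^ 320) (by norm_num) a_pos primeData consts_valid hT hsub tS255
  exact h256

/-- all Schur rows (lower triangle). -/
theorem schurLower : SchurNearG (sectorKernel true (gramCoeff O102B.a)) (usubCB (sectorKernel true (gramCoeff O102B.a)) (fun i r ↦ phiJoS O102B.a 256 4 i r) (fun i r ↦ psiMidOS O102B.a (((1 : ℕ) : ℝ) / ((1024 : ℕ) : ℝ)) 256 512 1024 4 (wvF (O102BCBOdd.vw.drop 256) 64 512) i r + psiMSoS O102B.a (((1 : ℕ) : ℝ) / ((2048 : ℕ) : ℝ)) (((4 : ℕ) : ℝ) / ((1 : ℕ) : ℝ)) (((1346682168655 : ℕ) : ℝ) * (1 / 2 ^ 40)) 256 1024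 4 (sFun O102B.sd1 O102B.csd) (sFun2 O102B.sdm O102B.csd) (sFun2 O102B.sdp O102B.csd) i r) (fun i ↦ dMidO O102B.a (((1 : ℕ) : ℝ) / ((1024 : ℕ) : ℝ)) 256 512 1024 4 (wvF (O102BCBOdd.vw.drop 256) 64 512) i + dgJo O102B.a (((1 : ℕ) : ℝ) / ((2048 : ℕ) : ℝ)) (((1346682168655 : ℕ) : ℝ) * (1 / 2 ^ 40)) 256 1024 4 i) 256 256 64 O102BCBOdd.v 8) 256 310 O102BCBOdd.rho O102BCBOdd.DS true 256 := schur256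

end Summit.RiemannHypothesis.RiemannHypothesis.Theorems.WeilFormatCData.O102BCBOdd

-- ===== from WeilFormatCDataO102BCBOddPsd10 =====
namespace Summit.RiemannHypothesis.RiemannHypothesis.Theorems.WeilFormatCData.O102BCBOdd
open Literature.NumberTheory.LFunctions Literature.NumberTheory.LFunctions.PsdDyadic Summit.RiemannHypothesis.RiemannHypothesis.Theorems.FormatCPsd

/-- **(P)**: `checkPsdMid 256 δ rho DS' L` (assembled from the row bands). -/
theorem checkPsdMid_holds : checkPsdMid 256 O102BCBOdd.δ O102BCBOdd.rho O102BCBOdd.DS' O102BCBOdd.L = true := by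
  have hshape : PsdDyadic.checkPsdShape 256 O102BCBOdd.DS' O102BCBOdd.L = true :=
    FormatCPsd.checkPsdShape_of_symmBands (not_not.mp tShapeLenb) fun i hi ↦ by
      rcases Nat.lt_or_ge i 105 with h0 | h0
      · exact ⟨0, 105, tSy0, by omega, by omega⟩
      rcases Nat.lt_or_ge i 149 with h1 | h1
      · exact ⟨105, 44, tSy105, by omega, by omega⟩
      rcases Nat.lt_or_ge i 182 with h2 | h2
      · exact ⟨149, 33, tSy149, by omega, by omega⟩
      rcases Nat.lt_or_ge i 196 with h3 | h3
      · exact ⟨182, 14, tSy182, by omega, by omega⟩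
      rcases Nat.lt_or_ge i 210 with h4 | h4
      · exact ⟨196, 14, tSy196, by omega, by omega⟩
      rcases Nat.lt_or_ge i 221 with h5 | h5
      · exact ⟨210, 11, tSy210, by omega, by omega⟩
      rcases Nat.lt_or_ge i 234 with h6 | h6
      · exact ⟨221, 13, tSy221, by omega, by omega⟩
      rcases Nat.lt_or_ge i 242 with h7 | h7
      · exact ⟨234, 8, tSy234, by omega, by omega⟩
      rcases Nat.lt_or_ge i 250 with h8 | h8
      · exact ⟨242, 8, tSy242, by omega, by omega⟩
      exact ⟨250, 6, tSy250, by omega, by omega⟩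
  refine checkPsdMid_of_bands hshape fun t ht ↦ ?_
  have hlen : t < DS'.length := by rw [tLen]; exact ht
  by_cases hb0 : t < 12
  · exact rowBudget_of_checkPsdBand tPB0 (by omega) (by omega) hlen
  by_cases hb12 : t < 24
  · exact rowBudget_of_checkPsdBand tPB12 (by omega) (by omega) hlen
  by_cases hb24 : t < 36
  · exact rowBudget_of_checkPsdBand tPB24 (by omega) (by omega) hlen
  by_cases hb36 : t < 48
  · exact rowBudget_of_checkPsdBand tPB36 (by omega) (by omega) hlen
  by_cases hb48 : t < 60
  · exact rowBudget_of_checkPsdBand tPB48 (by omega) (by omega) hlen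
  by_cases hb60 : t < 72
  · exact rowBudget_of_checkPsdBand tPB60 (by omega) (by omega) hlen
  by_cases hb72 : t < 84
  · exact rowBudget_of_checkPsdBand tPB72 (by omega) (by omega) hlen
  by_cases hb84 : t < 96
  · exact rowBudget_of_checkPsdBand tPB84 (by omega) (by omega) hlen
  by_cases hb96 : t < 108
  · exact rowBudget_of_checkPsdBand tPB96 (by omega) (by omega) hlen
  by_cases hb108 : t < 120
  · exact rowBudget_of_checkPsdBand tPB108 (by omega) (by omega) hlen
  by_cases hb120 : t < 132
  · exact rowBudget_of_checkPsdBand tPB120 (by omega) (by omega) hlen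
  by_cases hb132 : t < 144
  · exact rowBudget_of_checkPsdBand tPB132 (by omega) (by omega) hlen
  by_cases hb144 : t < 156
  · exact rowBudget_of_checkPsdBand tPB144 (by omega) (by omega) hlen
  by_cases hb156 : t < 168
  · exact rowBudget_of_checkPsdBand tPB156 (by omega) (by omega) hlen
  by_cases hb168 : t < 180
  · exact rowBudget_of_checkPsdBand tPB168 (by omega) (by omega) hlen
  by_cases hb180 : t < 192
  · exact rowBudget_of_checkPsdBand tPB180 (by omega) (by omega) hlen
  by_cases hb192 : t < 204
  · exact rowBudget_of_checkPsdBand tPB192 (by omega) (by omega) hlen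
  by_cases hb204 : t < 216
  · exact rowBudget_of_checkPsdBand tPB204 (by omega) (by omega) hlen
  by_cases hb216 : t < 228
  · exact rowBudget_of_checkPsdBand tPB216 (by omega) (by omega) hlen
  by_cases hb228 : t < 240
  · exact rowBudget_of_checkPsdBand tPB228 (by omega) (by omega) hlen
  by_cases hb240 : t < 252
  · exact rowBudget_of_checkPsdBand tPB240 (by omega) (by omega) hlen
  exact rowBudget_of_checkPsdBand tPB252 (by omega) (by omega) hlen

/-- **λ-run**: `DS' = DS − lamZ·1` on the whole `256 × 256` block (assembled from the row bands). -/
theorem hDS : ∀ k < 256, ∀ k' < 256, PsdDyadic.getMZ O102BCBOdd.DS' k k' = PsdDyadic.getMZ O102BCBOdd.DS k k' - (if k = k' then O102BCBOdd.lamZ else 0) := by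
  intro k hk
  by_cases hs0 : k < 12
  · exact WeilFormatC.diagShift_row_of_check tSh0 k (by omega) (by omega)
  by_cases hs12 : k < 24
  · exact WeilFormatC.diagShift_row_of_check tSh12 k (by omega) (by omega)
  by_cases hs24 : k < 36
  · exact WeilFormatC.diagShift_row_of_check tSh24 k (by omega) (by omega)
  by_cases hs36 : k < 48
  · exact WeilFormatC.diagShift_row_of_check tSh36 k (by omega) (by omega)
  by_cases hs48 : k < 60
  · exact WeilFormatC.diagShift_row_of_check tSh48 k (by omega) (by omega)
  by_cases hs60 : k < 72
  · exact WeilFormatC.diagShift_row_of_check tSh60 k (by omega) (by omega)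
  by_cases hs72 : k < 84
  · exact WeilFormatC.diagShift_row_of_check tSh72 k (by omega) (by omega)
  by_cases hs84 : k < 96
  · exact WeilFormatC.diagShift_row_of_check tSh84 k (by omega) (by omega)
  by_cases hs96 : k < 108
  · exact WeilFormatC.diagShift_row_of_check tSh96 k (by omega) (by omega)
  by_cases hs108 : k < 120
  · exact WeilFormatC.diagShift_row_of_check tSh108 k (by omega) (by omega)
  by_cases hs120 : k < 132
  · exact WeilFormatC.diagShift_row_of_check tSh120 k (by omega) (by omega)
  by_cases hs132 : k < 144
  · exact WeilFormatC.diagShift_row_of_check tSh132 k (by omega) (by omega)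
  by_cases hs144 : k < 156
  · exact WeilFormatC.diagShift_row_of_check tSh144 k (by omega) (by omega)
  by_cases hs156 : k < 168
  · exact WeilFormatC.diagShift_row_of_check tSh156 k (by omega) (by omega)
  by_cases hs168 : k < 180
  · exact WeilFormatC.diagShift_row_of_check tSh168 k (by omega) (by omega)
  by_cases hs180 : k < 192
  · exact WeilFormatC.diagShift_row_of_check tSh180 k (by omega) (by omega)
  by_cases hs192 : k < 204
  · exact WeilFormatC.diagShift_row_of_check tSh192 k (by omega) (by omega)
  by_cases hs204 : k < 216
  · exact WeilFormatC.diagShift_row_of_check tSh204 k (by omega) (by omega)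
  by_cases hs216 : k < 228
  · exact WeilFormatC.diagShift_row_of_check tSh216 k (by omega) (by omega)
  by_cases hs228 : k < 240
  · exact WeilFormatC.diagShift_row_of_check tSh228 k (by omega) (by omega)
  by_cases hs240 : k < 252
  · exact WeilFormatC.diagShift_row_of_check tSh240 k (by omega) (by omega)
  exact WeilFormatC.diagShift_row_of_check tSh252 k (by omega) (by omega)

end Summit.RiemannHypothesis.RiemannHypothesis.Theorems.WeilFormatCData.O102BCBOdd
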